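import Mathlib.Analysis.Normed.Group.Ultra
import Mathlib.Analysis.Normed.Module.FiniteDimension
import Mathlib.Topology.MetricSpace.HausdorffDistance
import Mathlib.LinearAlgebra.Dual.Lemmas
import HarnessLib

/-!
# Non-archimedean Hahn–Banach with loss on finite-dimensional subspaces (t-norming functionals)

Over a non-archimedean valued field `K` the Hahn–Banach theorem with norm-PRESERVING extension holds iff `K` is spherically
complete (Ingleton 1952). For FINITE-DIMENSIONAL subspaces and ANY loss factor `> 1`, however, extension is unconditional over
every complete non-archimedean field: this is the content of the existence of `t`-orthogonal bases (`0 < t < 1`) in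
finite-dimensional normed spaces, [cite: SchneiderNFA2002, Lemma 17.3] (see also van Rooij 1978, Thm 3.15; Perez-Garcia–Schikhof
2010, Thm 2.3.7), and it is what the cross-norm property of the non-archimedean projective tensor norm
([cite: SchneiderNFA2002, Prop. 17.4]) rests on.

This file proves, for an ultrametric normed space `V` over a nontrivially normed field `𝕜`:

* `exists_dual_eq_one_vanishing` — for `u ∉ W` an (algebraic) linear functional `χ` with `χ u = 1`, `χ|_W = 0`;
* `exists_extension_of_near_best` — ONE-STEP EXTENSION WITH LOSS: if `ψ` is bounded by `C` on a subspace `W` and `w₀ ∈ W` is a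
  `K`-near-best approximation of `-u` from `W` (`‖u + w₀‖ ≤ K ‖u + w‖` for all `w ∈ W`, `K ≥ 1`), then some `ψ'` agrees with `ψ` on
  `W` and is bounded by `K · C` on `W + 𝕜 u` (no spherical completeness: the slack `K > 1` replaces the attained best
  approximation of Ingleton's proof);
* `exists_dual_norming_on_span` — for `𝕜` COMPLETE, every finite set `S`, `v` with `‖v‖ ≠ 0` and `0 < t < 1`: a linear functional
  `ψ` on `V` with `ψ v = 1` and `t ‖v‖ ‖ψ x‖ ≤ ‖x‖` on `span (insert v S)` — i.e. `v` is `t`-normed by a functional of the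
  finite-dimensional subspace, [cite: SchneiderNFA2002, Lemma 17.3] in functional form (induction on `S`, loss `√t` per half).

The functionals are `Module.Dual` (algebraic); only their restrictions to the finite-dimensional span are normed. No new
definitions.
-/

namespace Literature.Analysis.OperatorTheory

open Metric Submodule

variable {𝕜 : Type*} [NontriviallyNormedField 𝕜] {V : Type*} [NormedAddCommGroup V] [NormedSpace 𝕜 V]

/-- For `u ∉ W` there is a linear functional on `V` vanishing on the subspace `W` with value `1` at `u` (linear algebra over a
field: a functional of `V ⧸ W` non-zero at the class of `u`). [cite: SchneiderNFA2002, Lemma 17.3] -/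
theorem exists_dual_eq_one_vanishing {W : Submodule 𝕜 V} {u : V} (hu : u ∉ W) :
    ∃ χ : Module.Dual 𝕜 V, χ u = 1 ∧ ∀ w ∈ W, χ w = 0 := by
  have hne : W.mkQ u ≠ 0 := by
    rw [Submodule.mkQ_apply, Ne, Submodule.Quotient.mk_eq_zero]
    exact hu
  obtain ⟨f, hf⟩ := Module.Projective.exists_dual_eq_one 𝕜 hne
  refine ⟨f ∘ₗ W.mkQ, by simpa using hf, fun w hw => ?_⟩
  rw [LinearMap.comp_apply, Submodule.mkQ_apply, (Submodule.Quotient.mk_eq_zero W).2 hw, map_zero]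

/-- **One-step extension with loss** (non-archimedean Hahn–Banach step without spherical completeness). Let `V` be ultrametric,
`ψ` a linear functional with `‖ψ w‖ ≤ C ‖w‖` on the subspace `W`, `u ∉ W`, and `w₀ ∈ W` a `K`-near-best approximation:
`‖u + w₀‖ ≤ K ‖u + w‖` for all `w ∈ W` (`K ≥ 1`). Then `ψ' := ψ - ψ(u + w₀) · χ` (`χ` as in `exists_dual_eq_one_vanishing`)
agrees with `ψ` on `W` and satisfies `‖ψ' x‖ ≤ K C ‖x‖` on `W ⊔ 𝕜 u`: for `x = w + c u`, `ψ' x = ψ(w - c w₀)` and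
`‖w - c w₀‖ = ‖x - c (u + w₀)‖ ≤ max (‖x‖, ‖c‖ ‖u + w₀‖) ≤ K ‖x‖`. [cite: SchneiderNFA2002, Lemma 17.3] -/
theorem exists_extension_of_near_best [IsUltrametricDist V] {W : Submodule 𝕜 V} {ψ : Module.Dual 𝕜 V} {C : ℝ}
    (hC : 0 ≤ C) (hψ : ∀ w ∈ W, ‖ψ w‖ ≤ C * ‖w‖) {u w₀ : V} (hu : u ∉ W) (hw₀ : w₀ ∈ W) {K : ℝ} (hK : 1 ≤ K)
    (hbest : ∀ w ∈ W, ‖u + w₀‖ ≤ K * ‖u + w‖) :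
    ∃ ψ' : Module.Dual 𝕜 V, (∀ w ∈ W, ψ' w = ψ w) ∧ ∀ x ∈ W ⊔ 𝕜 ∙ u, ‖ψ' x‖ ≤ K * C * ‖x‖ := by
  obtain ⟨χ, hχu, hχW⟩ := exists_dual_eq_one_vanishing hu
  refine ⟨ψ - ψ (u + w₀) • χ, fun w hw => by simp [hχW w hw], fun x hx => ?_⟩
  obtain ⟨w, hw, y, hy, rfl⟩ := Submodule.mem_sup.1 hx
  obtain ⟨c, rfl⟩ := Submodule.mem_span_singleton.1 hy
  have hval : (ψ - ψ (u + w₀) • χ) (w + c • u) = ψ (w - c • w₀) := by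
    simp only [LinearMap.sub_apply, LinearMap.smul_apply, map_add, map_smul, hχW w hw, hχu, smul_eq_mul, map_sub]
    ring
  rw [hval]
  have hmem : w - c • w₀ ∈ W := W.sub_mem hw (W.smul_mem c hw₀)
  have hKnn : 0 ≤ K := zero_le_one.trans hK
  have key : ‖w - c • w₀‖ ≤ K * ‖w + c • u‖ := by
    have h1 : w - c • w₀ = (w + c • u) + -(c • (u + w₀)) := by
      simp only [smul_add]
      abel
    rw [h1]
    refine (IsUltrametricDist.norm_add_le_max _ _).trans (max_le ?_ ?_)
    · exact le_mul_of_one_le_left (norm_nonneg _) hK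
    · rw [norm_neg]
      by_cases hc : c = 0
      · simp only [hc, zero_smul, norm_zero, add_zero]
        exact mul_nonneg hKnn (norm_nonneg _)
      · rw [norm_smul]
        have hb := hbest (c⁻¹ • w) (W.smul_mem _ hw)
        calc ‖c‖ * ‖u + w₀‖ ≤ ‖c‖ * (K * ‖u + c⁻¹ • w‖) := by gcongr
          _ = K * ‖c • (u + c⁻¹ • w)‖ := by rw [norm_smul]; ring
          _ = K * ‖w + c • u‖ := by rw [smul_add, smul_inv_smul₀ hc, add_comm]
  refine (hψ _ hmem).trans ?_
  calc C * ‖w - c • w₀‖ ≤ C * (K * ‖w + c • u‖) := by gcongr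
    _ = K * C * ‖w + c • u‖ := by ring

/-- **`t`-norming functionals on finite-dimensional subspaces** (non-archimedean Hahn–Banach with loss; functional form of the
existence of `t`-orthogonal bases, [cite: SchneiderNFA2002, Lemma 17.3]). Let `𝕜` be complete and `V` an ultrametric normed
`𝕜`-space. For every finite `S ⊆ V`, every `v` with `‖v‖ ≠ 0` and every `0 < t < 1` there is a linear functional `ψ` on `V`
with `ψ v = 1` and `t · ‖v‖ · ‖ψ x‖ ≤ ‖x‖` for all `x ∈ span (insert v S)`. Proof: induction on `S`; the new vector is either
already in the span, or at positive distance from it (finite-dimensional subspaces are closed over a complete field), in which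
case a `t^{-1/2}`-near-best approximation exists and `exists_extension_of_near_best` applies to the `√t`-norming functional of
the induction hypothesis. -/
theorem exists_dual_norming_on_span [IsUltrametricDist V] [CompleteSpace 𝕜] (S : Finset V) {v : V} (hv : ‖v‖ ≠ 0)
    {t : ℝ} (ht0 : 0 < t) (ht1 : t < 1) :
    ∃ ψ : Module.Dual 𝕜 V, ψ v = 1 ∧ ∀ x ∈ span 𝕜 (insert v (↑S : Set V)), t * ‖v‖ * ‖ψ x‖ ≤ ‖x‖ := by
  classical
  have hvpos : 0 < ‖v‖ := lt_of_le_of_ne (norm_nonneg v) (Ne.symm hv)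
  have hv0 : v ≠ 0 := fun h => hv (by rw [h, norm_zero])
  induction S using Finset.induction_on generalizing t with
  | empty =>
    obtain ⟨ψ, hψ⟩ := Module.Projective.exists_dual_eq_one 𝕜 hv0
    refine ⟨ψ, hψ, fun x hx => ?_⟩
    rw [Finset.coe_empty, insert_empty_eq, Submodule.mem_span_singleton] at hx
    obtain ⟨a, rfl⟩ := hx
    rw [map_smul, hψ, smul_eq_mul, mul_one, norm_smul]
    calc t * ‖v‖ * ‖a‖ ≤ 1 * ‖v‖ * ‖a‖ := by gcongr
      _ = ‖a‖ * ‖v‖ := by ring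
  | insert a S haS ih =>
    -- the half-loss parameter
    set s := Real.sqrt t with hs
    have hs0 : 0 < s := Real.sqrt_pos.2 ht0
    have hs1 : s < 1 := by
      rw [hs, ← Real.sqrt_one]
      exact Real.sqrt_lt_sqrt ht0.le ht1
    have hss : s * s = t := Real.mul_self_sqrt ht0.le
    obtain ⟨ψ, hψv, hψ⟩ := ih hs0 hs1
    set W : Submodule 𝕜 V := span 𝕜 (insert v (↑S : Set V)) with hW
    have hts : t ≤ s := by
      rw [← hss]
      exact mul_le_of_le_one_left hs0.le hs1.le
    by_cases ha : a ∈ W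
    · -- nothing new is spanned
      refine ⟨ψ, hψv, fun x hx => ?_⟩
      have hx' : x ∈ W := by
        refine (span_le.2 ?_ : span 𝕜 (insert v (↑(insert a S) : Set V)) ≤ W) hx
        rw [Finset.coe_insert]
        rintro y (rfl | rfl | hy)
        · exact subset_span (Set.mem_insert _ _)
        · exact ha
        · exact subset_span (Set.mem_insert_of_mem _ hy)
      calc t * ‖v‖ * ‖ψ x‖ ≤ s * ‖v‖ * ‖ψ x‖ := by gcongr
        _ ≤ ‖x‖ := hψ x hx'
    · -- `a ∉ W`: `W` is finite-dimensional, hence closed; near-best approximation with slack `s⁻¹`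
      haveI : FiniteDimensional 𝕜 W := FiniteDimensional.span_of_finite 𝕜 ((S.finite_toSet).insert v)
      have hWc : IsClosed (W : Set V) := W.closed_of_finiteDimensional
      have hWne : (W : Set V).Nonempty := ⟨0, W.zero_mem⟩
      have hd : 0 < infDist a (W : Set V) := (hWc.notMem_iff_infDist_pos hWne).1 ha
      have hlt : infDist a (W : Set V) < s⁻¹ * infDist a (W : Set V) :=
        lt_mul_left hd (one_lt_inv_iff₀.2 ⟨hs0, hs1⟩)
      obtain ⟨y, hyW, hy⟩ := (infDist_lt_iff hWne).1 hlt
      have hbest : ∀ w ∈ W, ‖a + -y‖ ≤ s⁻¹ * ‖a + w‖ := fun w hw => by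
        rw [← sub_eq_add_neg, ← dist_eq_norm]
        refine hy.le.trans (mul_le_mul_of_nonneg_left ?_ (inv_nonneg.2 hs0.le))
        have h := infDist_le_dist_of_mem (x := a) (W.neg_mem hw)
        rwa [dist_eq_norm, sub_neg_eq_add] at h
      have hC : 0 ≤ (s * ‖v‖)⁻¹ := inv_nonneg.2 (mul_nonneg hs0.le (norm_nonneg v))
      have hψC : ∀ w ∈ W, ‖ψ w‖ ≤ (s * ‖v‖)⁻¹ * ‖w‖ := fun w hw => by
        rw [inv_mul_eq_div, le_div_iff₀ (mul_pos hs0 hvpos)]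
        calc ‖ψ w‖ * (s * ‖v‖) = s * ‖v‖ * ‖ψ w‖ := by ring
          _ ≤ ‖w‖ := hψ w hw
      obtain ⟨ψ', hψ'W, hψ'⟩ := exists_extension_of_near_best hC hψC ha (W.neg_mem hyW)
        (one_le_inv_iff₀.2 ⟨hs0, hs1.le⟩) hbest
      refine ⟨ψ', by rw [hψ'W v (subset_span (Set.mem_insert _ _)), hψv], fun x hx => ?_⟩
      have hx' : x ∈ W ⊔ 𝕜 ∙ a := by
        refine (span_le.2 ?_ : span 𝕜 (insert v (↑(insert a S) : Set V)) ≤ W ⊔ 𝕜 ∙ a) hx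
        rw [Finset.coe_insert]
        rintro y (rfl | rfl | hy)
        · exact Submodule.mem_sup_left (subset_span (Set.mem_insert _ _))
        · exact Submodule.mem_sup_right (Submodule.mem_span_singleton_self _)
        · exact Submodule.mem_sup_left (subset_span (Set.mem_insert_of_mem _ hy))
      have hb := hψ' x hx'
      -- `‖ψ' x‖ ≤ s⁻¹ (s ‖v‖)⁻¹ ‖x‖ = (t ‖v‖)⁻¹ ‖x‖`
      have htv : 0 < t * ‖v‖ := mul_pos ht0 hvpos
      have hcoef : s⁻¹ * (s * ‖v‖)⁻¹ = (t * ‖v‖)⁻¹ := by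
        rw [← mul_inv, ← hss]; ring_nf
      rw [hcoef, inv_mul_eq_div, le_div_iff₀ htv] at hb
      calc t * ‖v‖ * ‖ψ' x‖ = ‖ψ' x‖ * (t * ‖v‖) := by ring
        _ ≤ ‖x‖ := hb

/-- **`t`-orthogonal spanning families** ([cite: SchneiderNFA2002, Lemma 17.3] in its usual form: every finite-dimensional
subspace has, for each `0 < t < 1`, a `t`-orthogonal basis). Let `𝕜` be complete and `V` an ultrametric normed `𝕜`-space. For every
finite `S ⊆ V` and `0 < t < 1` there are finitely many NON-ZERO vectors `u_0, …, u_{n-1}` whose span contains `S` and which are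
`t`-orthogonal: `t · ‖a_k‖ · ‖u_k‖ ≤ ‖Σ_j a_j • u_j‖` for every coefficient vector `a` and every `k`. Proof: induction on `S`; a new
vector outside the (closed, finite-dimensional) span `W` is replaced by `u' = s - y` with `y ∈ W` a `t^{-1/2}`-near-best
approximation, which is `√t`-orthogonal to `W` (`‖w + b u'‖ ≥ √t · max (‖w‖, ‖b‖ ‖u'‖)`), and the induction hypothesis is used
with `√t`. -/
theorem exists_tOrthogonal_family [IsUltrametricDist V] [CompleteSpace 𝕜] (S : Finset V) {t : ℝ} (ht0 : 0 < t)
    (ht1 : t < 1) :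
    ∃ (n : ℕ) (u : Fin n → V), (∀ k, u k ≠ 0) ∧ (↑S ⊆ (span 𝕜 (Set.range u) : Set V)) ∧
      ∀ (a : Fin n → 𝕜) (k : Fin n), t * (‖a k‖ * ‖u k‖) ≤ ‖∑ j, a j • u j‖ := by
  classical
  induction S using Finset.induction_on generalizing t with
  | empty => exact ⟨0, Fin.elim0, fun k => k.elim0, by simp, fun a k => k.elim0⟩
  | insert s S hsS ih =>
    set r := Real.sqrt t with hr
    have hr0 : 0 < r := Real.sqrt_pos.2 ht0
    have hr1 : r < 1 := by
      rw [hr, ← Real.sqrt_one]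
      exact Real.sqrt_lt_sqrt ht0.le ht1
    have hrr : r * r = t := Real.mul_self_sqrt ht0.le
    have htr : t ≤ r := by
      rw [← hrr]
      exact mul_le_of_le_one_left hr0.le hr1.le
    obtain ⟨n, u, hu0, huS, hu⟩ := ih hr0 hr1
    set W : Submodule 𝕜 V := span 𝕜 (Set.range u) with hW
    by_cases hs : s ∈ W
    · -- nothing new is spanned: keep the family, weaken `r` to `t`
      refine ⟨n, u, hu0, ?_, fun a k => (mul_le_mul_of_nonneg_right htr (by positivity)).trans (hu a k)⟩
      rw [Finset.coe_insert]
      exact Set.insert_subset hs huS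
    · -- `s ∉ W`: replace `s` by `u' = s - y`, `y ∈ W` a `r⁻¹`-near-best approximation
      haveI : FiniteDimensional 𝕜 W := FiniteDimensional.span_of_finite 𝕜 (Set.finite_range u)
      have hWc : IsClosed (W : Set V) := W.closed_of_finiteDimensional
      have hWne : (W : Set V).Nonempty := ⟨0, W.zero_mem⟩
      have hd : 0 < infDist s (W : Set V) := (hWc.notMem_iff_infDist_pos hWne).1 hs
      have hlt : infDist s (W : Set V) < r⁻¹ * infDist s (W : Set V) :=
        lt_mul_left hd (one_lt_inv_iff₀.2 ⟨hr0, hr1⟩)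
      obtain ⟨y, hyW, hy⟩ := (infDist_lt_iff hWne).1 hlt
      set u' : V := s - y with hu'
      have hu'0 : u' ≠ 0 := fun h => hs (by rw [sub_eq_zero.1 h]; exact hyW)
      -- `√t`-orthogonality of `u'` against `W`
      have hdu : r * ‖u'‖ < infDist s (W : Set V) := by
        rw [hu', ← dist_eq_norm]
        calc r * dist s y < r * (r⁻¹ * infDist s (W : Set V)) := mul_lt_mul_of_pos_left hy hr0
          _ = infDist s (W : Set V) := by rw [← mul_assoc, mul_inv_cancel₀ hr0.ne', one_mul]
      have step1 : ∀ w ∈ W, ∀ b : 𝕜, r * (‖b‖ * ‖u'‖) ≤ ‖w + b • u'‖ := by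
        intro w hw b
        by_cases hb : b = 0
        · simp only [hb, norm_zero, zero_mul, mul_zero, zero_smul, add_zero]
          exact norm_nonneg _
        · have hmem : y - b⁻¹ • w ∈ W := W.sub_mem hyW (W.smul_mem _ hw)
          have h1 : infDist s (W : Set V) ≤ ‖s - (y - b⁻¹ • w)‖ := by
            rw [← dist_eq_norm]
            exact infDist_le_dist_of_mem hmem
          have h2 : w + b • u' = b • (s - (y - b⁻¹ • w)) := by
            rw [hu', smul_sub, smul_sub, smul_sub, smul_inv_smul₀ hb]
            abel
          rw [h2, norm_smul]
          calc r * (‖b‖ * ‖u'‖) = ‖b‖ * (r * ‖u'‖) := by ring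
            _ ≤ ‖b‖ * ‖s - (y - b⁻¹ • w)‖ := by gcongr; exact hdu.le.trans h1
      have step2 : ∀ w ∈ W, ∀ b : 𝕜, r * ‖w‖ ≤ ‖w + b • u'‖ := by
        intro w hw b
        have h1 : ‖w‖ ≤ max ‖w + b • u'‖ (‖b‖ * ‖u'‖) := by
          have h := IsUltrametricDist.norm_add_le_max (w + b • u') (-(b • u'))
          rwa [add_neg_cancel_right, norm_neg, norm_smul] at h
        rcases le_max_iff.1 h1 with h | h
        · exact (mul_le_of_le_one_left (norm_nonneg _) hr1.le).trans h
        · calc r * ‖w‖ ≤ r * (‖b‖ * ‖u'‖) := by gcongr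
            _ ≤ ‖w + b • u'‖ := step1 w hw b
      refine ⟨n + 1, Fin.cons u' u, Fin.cases hu'0 hu0, ?_, fun a k => ?_⟩
      · -- span contains `insert s S`
        rw [Finset.coe_insert]
        have hW' : W ≤ span 𝕜 (Set.range (Fin.cons u' u : Fin (n + 1) → V)) :=
          span_mono fun v ⟨k, hk⟩ => ⟨k.succ, by rw [← hk]; rfl⟩
        refine Set.insert_subset ?_ (huS.trans hW')
        have hsu : s = u' + y := by rw [hu', sub_add_cancel]
        rw [hsu]
        exact Submodule.add_mem _ (subset_span ⟨0, rfl⟩) (hW' hyW)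
      · -- `t`-orthogonality of `Fin.cons u' u`
        have hsum : ∑ j, a j • (Fin.cons u' u : Fin (n + 1) → V) j = (∑ j : Fin n, a j.succ • u j) + a 0 • u' := by
          rw [Fin.sum_univ_succ, add_comm]
          rfl
        have hw : (∑ j : Fin n, a j.succ • u j) ∈ W :=
          W.sum_mem fun j _ => W.smul_mem _ (subset_span ⟨j, rfl⟩)
        rw [hsum]
        refine Fin.cases ?_ (fun k => ?_) k
        · -- the new vector
          calc t * (‖a 0‖ * ‖(Fin.cons u' u : Fin (n + 1) → V) 0‖) ≤ r * (‖a 0‖ * ‖u'‖) :=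
                mul_le_mul_of_nonneg_right htr (by positivity)
            _ ≤ _ := step1 _ hw (a 0)
        · -- an old vector
          calc t * (‖a k.succ‖ * ‖(Fin.cons u' u : Fin (n + 1) → V) k.succ‖) = r * (r * (‖a k.succ‖ * ‖u k‖)) := by
                rw [← hrr, mul_assoc]; rfl
            _ ≤ r * ‖∑ j : Fin n, a j.succ • u j‖ := by gcongr; exact hu (fun j => a j.succ) k
            _ ≤ _ := step2 _ hw (a 0)

end Literature.Analysis.OperatorTheory
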